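import Literature.Analysis.FluidPDE.OseenDuhamelHeatLowPassL2
import Literature.Analysis.FluidPDE.ForcedOseenRepresentationClassical
import Literature.Analysis.FluidPDE.TaoFiniteEnergyLerayHopf
import Literature.Analysis.FluidPDE.LeraySeparationOfEnergyTools
import Literature.Analysis.UnboundedOperators.HeatSmoothingDefect
import HarnessLib

/-!
# Finite-energy classical solutions on `ℝ³`: the heat low-pass is uniformly small, good times exist

Analysis/FluidPDE proof file (theorems only; no definitions, no named facts). Second of three files
proving the `L²` decay `‖u(t)‖₂ → 0` of finite-energy classical solutions of Navier–Stokes on `ℝ³`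
(Masuda 1984; Kato 1984, §4) — see `FiniteEnergyClassicalL2Decay.lean` for the theorem and the whole
argument. For a classical solution `(u, p)` of the unforced system on a slab `[0, T] × ℝ³` (`ν > 0`)
with `∫|u(t)|² ≤ A < ∞`:

* `EnergyDecay.exists_eLpNorm_two_heatExtension_slice_le` — if moreover `|u| ≤ M` on the slab, then for
  `0 < t ≤ T`, `s > 0`: `‖e^{νsΔ}u(t)‖₂ ≤ ‖e^{νsΔ}u(0)‖₂ + A · C ν^{-5/4} s^{-1/4}`, uniformly in `t`,
  `T`, `M` (Oseen representation `u(t) = e^{νtΔ}u(0) - B^ν_0(u,u)(t)` a.e., tree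
  `IsClassicalNSSolutionOn.ae_eq_forced_oseenMild` with zero force — Lemarié-Rieusset 2016 Thm. 6.1 /
  Tao 2013 Lemma 8.1 — plus the tools of `OseenDuhamelHeatLowPassL2.lean`);
* `EnergyDecay.energy_facts`, `EnergyDecay.exists_good_time` — `‖u(t)‖₂` is non-increasing,
  `ν∫₀ᵀ∫|∇u|² ≤ ½∫|u(0)|²` (Tao 2013 Lemma 8.1 sharp form = Leray's energy equality, tree
  `IsClassicalNSSolutionOn.energyEq_of_finiteEnergy`), hence if `ν δ T > ½∫|u(0)|²` some `τ ∈ (0, T)`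
  has `∫|∇u(τ)|² ≤ δ` (Leray 1934 §34); `EnergyDecay.lintegral_Ioi_dissipation_le` — the global budget
  `ν ∫₀^∞∫|∇u|² ≤ ½∫|u(0)|²` for solutions on every slab with uniformly bounded energy;
* `EnergyDecay.eLpNorm_sub_heatExtension_le_of_dissipation` — at such a time
  `‖u(τ) - e^{σΔ}u(τ)‖₂ ≤ √(3σδ)` (Ledoux's heat-flow defect, tree `integral_norm_sq_sub_heatExtension_le`).

## References

* K. Masuda, Tôhoku Math. J. 36 (1984) 623–646, Thm. 4 and Cor. 2, pp. 628–629. [Masuda1984]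
* T. Kato, Math. Z. 187 (1984) 471–480, §4. [Kato1984]
* J. Leray, Acta Math. 63 (1934), §17 (3.4), §34. [Leray1934]
* T. Tao, Anal. PDE 6 (2013) = arXiv:1108.1165, Lemma 8.1. [Tao2011]
* P. G. Lemarié-Rieusset, *The Navier–Stokes Problem in the 21st Century* (2016), Thm. 6.1, Prop. 6.5.
  [LemarieRieusset2016]
* M. Ledoux, Math. Res. Lett. 10 (2003), §1. [Ledoux2003]
-/

noncomputable section

open MeasureTheory Set Function Filter Metric Real
open _root_.Topology
open scoped ENNReal NNReal

namespace Literature.Analysis.FluidPDE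

open UnboundedOperators (heatKernel heatExtension)

namespace EnergyDecay

/-! ### 1. The heat low-pass of the solution: `‖e^{νsΔ}u(t)‖₂ ≤ ‖e^{νsΔ}u(0)‖₂ + A·C ν^{-5/4} s^{-1/4}` -/

/-- `L²` membership of a continuous slice with finite `∫|v|²` bounded by `A ≠ ⊤`. [folklore] -/
private theorem memLp_two_of_le {v : EuclideanSpace ℝ (Fin 3) → EuclideanSpace ℝ (Fin 3)} (hv : Continuous v)
    {A : ℝ≥0∞} (hAt : A ≠ ⊤) (h : ∫⁻ x, ‖v x‖ₑ ^ 2 ≤ A) : MemLp v 2 volume :=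
  memLp_two_of_lintegral_lt_top hv (h.trans_lt hAt.lt_top)

/-- **The heat low-pass of the solution is uniformly small at large smoothing times** — the slab
lemma: there is a universal `C ≥ 0` such that for every classical solution `(u, p)` of the unforced
Navier–Stokes system on `[0, T] × ℝ³` (`ν > 0`) with `∫|u(t)|² ≤ A < ∞` and `|u| ≤ M` on the slab, all
`0 < t ≤ T` and `s > 0`,
`‖e^{νsΔ}u(t)‖_{L²} ≤ ‖e^{νsΔ}u(0)‖_{L²} + A · C ν^{-5/4} s^{-1/4}`.
Mechanism: the Oseen representation `u(t) = e^{νtΔ}u(0) - B^ν_0(u,u)(t)` a.e. (Lemarié-Rieusset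
2016 Thm. 6.1 / Tao 2013 Lemma 8.1, tree `IsClassicalNSSolutionOn.ae_eq_forced_oseenMild` with zero
force), the semigroup law and `L²` contraction for the free part, and the energy-level bound of the
heat flow of the Duhamel term (`exists_eLpNorm_two_heat_oseenDuhamel_le`). The right-hand side does
not depend on `t`, `T` or `M`. [cite: LemarieRieusset2016, Thm. 6.1 with Prop. 6.5 (pp. 133–136)]
[cite: Kato1984, §4] -/
theorem exists_eLpNorm_two_heatExtension_slice_le :
    ∃ C : ℝ, 0 ≤ C ∧ ∀ {ν T : ℝ}, 0 < ν → 0 < T →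
      ∀ {u : ℝ → EuclideanSpace ℝ (Fin 3) → EuclideanSpace ℝ (Fin 3)}
        {p : ℝ → EuclideanSpace ℝ (Fin 3) → ℝ}, IsClassicalNSSolutionOn (Icc 0 T) ν 0 u p →
        ∀ {A : ℝ≥0∞}, A ≠ ⊤ → (∀ t ∈ Icc 0 T, ∫⁻ x, ‖u t x‖ₑ ^ 2 ≤ A) →
          ∀ {M : ℝ}, 0 < M → (∀ t ∈ Icc 0 T, ∀ y, ‖u t y‖ ≤ M) →
            ∀ {t s : ℝ}, t ∈ Ioc 0 T → 0 < s →
              eLpNorm (heatExtension (u t) (ν * s)) 2 volume ≤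
                eLpNorm (heatExtension (u 0) (ν * s)) 2 volume +
                  A * ENNReal.ofReal (C * ν ^ (-(5 / 4 : ℝ)) * s ^ (-(1 / 4 : ℝ))) := by
  obtain ⟨C, hC, hB⟩ := exists_eLpNorm_two_heat_oseenDuhamel_le
  refine ⟨C, hC, fun {ν} {T} hν hT {u} {p} hcl {A} hAt hA {M} hM hbd {t} {s} ht hs => ?_⟩
  have h12 : (1 : ℝ≥0∞) ≤ 2 := by norm_num
  have htI : t ∈ Icc 0 T := ⟨ht.1.le, ht.2⟩
  have h0I : (0 : ℝ) ∈ Icc 0 T := ⟨le_rfl, hT.le⟩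
  have hνt : 0 < ν * t := mul_pos hν ht.1
  have hνs : 0 < ν * s := mul_pos hν hs
  -- `L²` slices
  have hu0 : MemLp (u 0) 2 volume :=
    memLp_two_of_le (hcl.contDiff_velocity h0I).continuous hAt (hA 0 h0I)
  have hut : MemLp (u t) 2 volume :=
    memLp_two_of_le (hcl.contDiff_velocity htI).continuous hAt (hA t htI)
  -- the Oseen representation with zero force
  have hrep := hcl.ae_eq_forced_oseenMild hν hT (G := 0) (by exact continuous_const)
    (fun τ _ y => by simp) (fun τ _ θ _ => by simp) (G₂ := 0) ENNReal.zero_ne_top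
    (fun τ _ => by simp) ⟨A, hAt.lt_top, hA⟩ hM hbd ht
  have hF0 : ∀ x, forceDuhamel ν 0 (0 : ℝ → EuclideanSpace ℝ (Fin 3) → EuclideanSpace ℝ (Fin 3)) t x
      = 0 := by
    intro x
    simp [forceDuhamel, UnboundedOperators.heatExtension_apply]
  set H : EuclideanSpace ℝ (Fin 3) → EuclideanSpace ℝ (Fin 3) := heatExtension (u 0) (ν * t) with hH
  set Bt : EuclideanSpace ℝ (Fin 3) → EuclideanSpace ℝ (Fin 3) := oseenDuhamel ν 0 u u t with hBt
  have hrep' : u t =ᵐ[volume] H - Bt := by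
    filter_upwards [hrep] with x hx
    rw [hx, hF0 x, add_zero]
    rfl
  have hHm : MemLp H 2 volume := UnboundedOperators.memLp_heatExtension_holds hu0 h12 hνt
  have hBm : MemLp Bt 2 volume := by
    refine (hHm.sub hut).ae_eq ?_
    filter_upwards [hrep'] with x hx
    simp only [Pi.sub_apply] at hx ⊢
    rw [hx, sub_sub_cancel]
  -- apply the heat flow
  have hsplit : heatExtension (u t) (ν * s) =
      heatExtension H (ν * s) - heatExtension Bt (ν * s) := by
    rw [heatExtension_congr_ae hrep', heatExtension_sub_eq_of_memLp hHm hBm h12 hνs]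
  -- the free part
  have hfree : eLpNorm (heatExtension H (ν * s)) 2 volume ≤
      eLpNorm (heatExtension (u 0) (ν * s)) 2 volume := by
    rw [hH, UnboundedOperators.heatExtension_add_holds hu0 h12 hνt hνs, add_comm]
    exact eLpNorm_two_heatExtension_add_le hu0 hνs hνt
  -- the Duhamel part through the clamp
  obtain ⟨w, hwm, -, hw, hwrep⟩ := exists_clamp_heatExtension_oseenDuhamel_eq hν hT
    hcl.smooth_velocity.continuousOn hbd
  have hduh : eLpNorm (heatExtension Bt (ν * s)) 2 volume ≤
      A * ENNReal.ofReal (C * ν ^ (-(5 / 4 : ℝ)) * s ^ (-(1 / 4 : ℝ))) := by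
    have heq : heatExtension Bt (ν * s) =
        fun x => ∫ τ in Ioo 0 t, ∫ y, oseenKernel (ν * (t + s - τ)) (x - y) (w τ y) (w τ y) :=
      funext fun x => hwrep ht hs x
    rw [heq]
    refine hB hν hwm ht.1 hs fun τ hτ => ?_
    rw [hw τ ⟨hτ.1.le, hτ.2.le.trans ht.2⟩]
    exact hA τ ⟨hτ.1.le, hτ.2.le.trans ht.2⟩
  have hm1 : AEStronglyMeasurable (heatExtension H (ν * s)) volume :=
    (UnboundedOperators.memLp_heatExtension_holds hHm h12 hνs).1
  have hm2 : AEStronglyMeasurable (heatExtension Bt (ν * s)) volume :=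
    (UnboundedOperators.memLp_heatExtension_holds hBm h12 hνs).1
  calc eLpNorm (heatExtension (u t) (ν * s)) 2 volume
      ≤ eLpNorm (heatExtension H (ν * s)) 2 volume + eLpNorm (heatExtension Bt (ν * s)) 2 volume := by
        rw [hsplit]
        exact eLpNorm_sub_le hm1 hm2 h12
    _ ≤ _ := add_le_add hfree hduh

/-! ### 2. Energy: monotone `L²` norm, finite dissipation, good times -/

/-- **The energy class and the energy equality on a slab** (Tao 2013, Lemma 8.1, sharp form; Leray
1934 (3.4); tree `IsClassicalNSSolutionOn.energyEq_of_finiteEnergy`), repackaged: for a finite-energy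
classical solution of the unforced system on `[0, T] × ℝ³`, (i) `t ↦ ‖u(t)‖_{L²}` is non-increasing on
`[0, T]`, and (ii) the dissipation is finite and paid for by the initial energy:
`ν ∫₀ᵀ∫ |∇u|² ≤ ½ ∫ |u(0)|²` (kinetic-energy normalisation of the tree). [cite: Tao2011, Lemma 8.1]
[cite: Leray1934, §17 (3.4)] -/
theorem energy_facts {ν T : ℝ} {u : ℝ → EuclideanSpace ℝ (Fin 3) → EuclideanSpace ℝ (Fin 3)}
    {p : ℝ → EuclideanSpace ℝ (Fin 3) → ℝ} (hcl : IsClassicalNSSolutionOn (Icc 0 T) ν 0 u p)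
    (hν : 0 < ν) (hT : 0 < T) (hfe : ∃ A : ℝ≥0∞, A < ⊤ ∧ ∀ t ∈ Icc 0 T, ∫⁻ x, ‖u t x‖ₑ ^ 2 ≤ A) :
    (∀ {s t : ℝ}, 0 ≤ s → s ≤ t → t ≤ T → eLpNorm (u t) 2 volume ≤ eLpNorm (u s) 2 volume) ∧
    (∫⁻ τ in Ioo 0 T, ∫⁻ x, ENNReal.ofReal (frobeniusNormSq (fderiv ℝ (u τ) x))) ≠ ⊤ ∧
    ν * (∫⁻ τ in Ioo 0 T, ∫⁻ x, ENNReal.ofReal (frobeniusNormSq (fderiv ℝ (u τ) x))).toReal ≤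
      VectorCalculus.kineticEnergy (u 0) := by
  obtain ⟨A, hAt, hA, -, hgrad⟩ :=
    hcl.energyClass_of_finiteEnergy tao_finite_energy_smooth_energy_bound_holds hν hT hfe
  have hu₃ := hcl.lintegral_enorm_pow_three_lt_top hAt hA hgrad
  have hid : ∀ {s t : ℝ}, 0 ≤ s → s ≤ t → t ≤ T →
      VectorCalculus.kineticEnergy (u t) +
        ν * (∫⁻ τ in Ioo s t, ∫⁻ x, ENNReal.ofReal (frobeniusNormSq (fderiv ℝ (u τ) x))).toReal =
      VectorCalculus.kineticEnergy (u s) := fun hs hst htT =>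
    hcl.energyEq_of_finiteEnergy tao_pressure_normalisation_holds
      tao2011_pressureTerm_estimate_holds hν hT hAt hA hgrad hu₃ hs hst htT
  have hmem : ∀ τ ∈ Icc 0 T, MemLp (u τ) 2 volume := fun τ hτ =>
    memLp_two_of_le (hcl.contDiff_velocity hτ).continuous hAt (hA τ hτ)
  refine ⟨fun {s} {t} hs hst htT => ?_, hgrad.ne, ?_⟩
  · -- monotone `L²` norm
    have h := hid hs hst htT
    have hD : 0 ≤ ν * (∫⁻ τ in Ioo s t, ∫⁻ x,
        ENNReal.ofReal (frobeniusNormSq (fderiv ℝ (u τ) x))).toReal :=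
      mul_nonneg hν.le ENNReal.toReal_nonneg
    have hKE : VectorCalculus.kineticEnergy (u t) ≤ VectorCalculus.kineticEnergy (u s) := by linarith
    have ht' : t ∈ Icc 0 T := ⟨hs.trans hst, htT⟩
    have hs' : s ∈ Icc 0 T := ⟨hs, hst.trans htT⟩
    have he : eEnergy (u t) ≤ eEnergy (u s) := by
      rw [eEnergy_eq_ofReal _ (hmem t ht'), eEnergy_eq_ofReal _ (hmem s hs')]
      exact ENNReal.ofReal_le_ofReal (by linarith)
    have h2 : ∀ {v : EuclideanSpace ℝ (Fin 3) → EuclideanSpace ℝ (Fin 3)},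
        eLpNorm v 2 volume = (eEnergy v) ^ (1 / 2 : ℝ) := by
      intro v
      rw [eEnergy, eLpNorm_eq_lintegral_rpow_enorm_toReal two_ne_zero ENNReal.ofNat_ne_top,
        ENNReal.toReal_ofNat]
      simp
    rw [h2, h2]
    exact ENNReal.rpow_le_rpow he (by norm_num)
  · -- dissipation budget
    have h := hid le_rfl hT.le le_rfl
    linarith [kineticEnergy_nonneg (u T)]

/-- **Good times**: if the slab is long enough that `ν δ T > ½∫|u(0)|²`, some time `τ ∈ (0, T)` has
small dissipation rate, `∫ |∇u(τ)|² ≤ δ` (Chebyshev in time on the finite dissipation integral). This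
is the `ℝ³` substitute for the missing Poincaré inequality in the decay argument (Leray 1934 §34;
Masuda 1984, §5, proof of Thm. 4). [cite: Leray1934, §34] -/
theorem exists_good_time {ν T : ℝ} {u : ℝ → EuclideanSpace ℝ (Fin 3) → EuclideanSpace ℝ (Fin 3)}
    {p : ℝ → EuclideanSpace ℝ (Fin 3) → ℝ} (hcl : IsClassicalNSSolutionOn (Icc 0 T) ν 0 u p)
    (hν : 0 < ν) (hT : 0 < T) (hfe : ∃ A : ℝ≥0∞, A < ⊤ ∧ ∀ t ∈ Icc 0 T, ∫⁻ x, ‖u t x‖ₑ ^ 2 ≤ A)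
    {δ : ℝ} (hδ : 0 < δ) (hTδ : VectorCalculus.kineticEnergy (u 0) < ν * δ * T) :
    ∃ τ ∈ Ioo 0 T, ∫⁻ x, ENNReal.ofReal (frobeniusNormSq (fderiv ℝ (u τ) x)) ≤ ENNReal.ofReal δ := by
  obtain ⟨-, hDt, hDle⟩ := energy_facts hcl hν hT hfe
  by_contra h
  push Not at h
  set D := ∫⁻ τ in Ioo 0 T, ∫⁻ x, ENNReal.ofReal (frobeniusNormSq (fderiv ℝ (u τ) x)) with hD
  have hlow : ENNReal.ofReal δ * ENNReal.ofReal T ≤ D := by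
    have hvol : (volume : Measure ℝ) (Ioo 0 T) = ENNReal.ofReal T := by
      rw [Real.volume_Ioo, sub_zero]
    calc ENNReal.ofReal δ * ENNReal.ofReal T
        = ∫⁻ _ in Ioo 0 T, ENNReal.ofReal δ := by rw [setLIntegral_const, hvol]
      _ ≤ D := setLIntegral_mono' measurableSet_Ioo fun τ hτ => (h τ hτ).le
  have hreal : δ * T ≤ D.toReal := by
    have := ENNReal.toReal_mono hDt hlow
    rwa [ENNReal.toReal_mul, ENNReal.toReal_ofReal hδ.le, ENNReal.toReal_ofReal hT.le] at this
  have : ν * (δ * T) ≤ ν * D.toReal := mul_le_mul_of_nonneg_left hreal hν.le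
  linarith

/-- **Global dissipation budget** (Leray 1934 (3.4); Tao 2013 Lemma 8.1): for a classical solution of the
unforced system on every slab `[0, T] × ℝ³` (`ν > 0`) with uniformly bounded energy, the space–time
dissipation over ALL of `(0, ∞)` is paid for by the initial kinetic energy:
`ν ∫₀^∞ ∫ |∇u|²_F ≤ ½ ∫ |u(0)|²` (slab budgets of `energy_facts`, exhausting `(0, ∞)` by unit time intervals).
[cite: Leray1934, §17 (3.4)] [cite: Tao2011, Lemma 8.1] -/
theorem lintegral_Ioi_dissipation_le {ν : ℝ} (hν : 0 < ν)
    {u : ℝ → EuclideanSpace ℝ (Fin 3) → EuclideanSpace ℝ (Fin 3)}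
    {p : ℝ → EuclideanSpace ℝ (Fin 3) → ℝ}
    (hcl : ∀ T : ℝ, 0 < T → IsClassicalNSSolutionOn (Icc 0 T) ν 0 u p)
    (hE : ∃ C : ℝ≥0∞, C < ⊤ ∧ ∀ t : ℝ, 0 ≤ t → ∫⁻ x, ‖u t x‖ₑ ^ 2 ≤ C) :
    ENNReal.ofReal ν * ∫⁻ τ in Ioi 0, ∫⁻ x, ENNReal.ofReal (frobeniusNormSq (fderiv ℝ (u τ) x)) ≤
      ENNReal.ofReal (VectorCalculus.kineticEnergy (u 0)) := by
  obtain ⟨A, hAt, hA⟩ := hE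
  set F : ℝ → ℝ≥0∞ := fun τ => ∫⁻ x, ENNReal.ofReal (frobeniusNormSq (fderiv ℝ (u τ) x)) with hF
  -- slab budgets
  have hslab : ∀ n : ℕ, ENNReal.ofReal ν * ∫⁻ τ in Ioo 0 ((n : ℝ) + 1), F τ ≤
      ENNReal.ofReal (VectorCalculus.kineticEnergy (u 0)) := by
    intro n
    have hT : (0 : ℝ) < (n : ℝ) + 1 := by positivity
    obtain ⟨-, hDt, hDle⟩ := energy_facts (hcl _ hT) hν hT ⟨A, hAt, fun t ht => hA t ht.1⟩
    rw [← ENNReal.ofReal_toReal hDt, ← ENNReal.ofReal_mul hν.le]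
    exact ENNReal.ofReal_le_ofReal hDle
  -- exhaust `(0, ∞)` by the unit intervals `(n, n+1]` (no measurability of `F` in `τ` is needed)
  have hcover : Ioi (0 : ℝ) ⊆ ⋃ n : ℕ, Ioc (n : ℝ) ((n : ℝ) + 1) := by
    intro τ hτ
    simp only [mem_iUnion, mem_Ioc]
    refine ⟨⌈τ⌉₊ - 1, ?_, ?_⟩
    · have h1 : (1 : ℕ) ≤ ⌈τ⌉₊ := Nat.one_le_ceil_iff.2 hτ
      have h2 : ((⌈τ⌉₊ - 1 : ℕ) : ℝ) = (⌈τ⌉₊ : ℝ) - 1 := by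
        rw [Nat.cast_sub h1, Nat.cast_one]
      rw [h2]
      linarith [Nat.ceil_lt_add_one (le_of_lt (mem_Ioi.1 hτ))]
    · have h1 : (1 : ℕ) ≤ ⌈τ⌉₊ := Nat.one_le_ceil_iff.2 hτ
      have h2 : ((⌈τ⌉₊ - 1 : ℕ) : ℝ) = (⌈τ⌉₊ : ℝ) - 1 := by
        rw [Nat.cast_sub h1, Nat.cast_one]
      rw [h2]
      linarith [Nat.le_ceil τ]
  -- partial sums over the unit intervals are slab integrals
  have hpartial : ∀ N : ℕ, ∑ n ∈ Finset.range N, ∫⁻ τ in Ioc (n : ℝ) ((n : ℝ) + 1), F τ =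
      ∫⁻ τ in Ioc (0 : ℝ) (N : ℝ), F τ := by
    intro N
    induction N with
    | zero => simp
    | succ N ih =>
      rw [Finset.sum_range_succ, ih]
      have hdisj : Disjoint (Ioc (0 : ℝ) (N : ℝ)) (Ioc (N : ℝ) ((N : ℝ) + 1)) :=
        Ioc_disjoint_Ioc_of_le le_rfl
      rw [← lintegral_union measurableSet_Ioc hdisj, Ioc_union_Ioc_eq_Ioc (Nat.cast_nonneg N)
        (by linarith), Nat.cast_succ]
  have hsum_le : ∑' n : ℕ, ∫⁻ τ in Ioc (n : ℝ) ((n : ℝ) + 1), F τ ≤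
      ⨆ N : ℕ, ∫⁻ τ in Ioo (0 : ℝ) ((N : ℝ) + 1), F τ := by
    rw [ENNReal.tsum_eq_iSup_nat]
    refine iSup_mono fun N => ?_
    rw [hpartial N]
    exact lintegral_mono_set (Ioc_subset_Ioo_right (by linarith))
  calc ENNReal.ofReal ν * ∫⁻ τ in Ioi 0, F τ
      ≤ ENNReal.ofReal ν * ∫⁻ τ in ⋃ n : ℕ, Ioc (n : ℝ) ((n : ℝ) + 1), F τ :=
        mul_le_mul_right (lintegral_mono_set hcover) _
    _ ≤ ENNReal.ofReal ν * ∑' n : ℕ, ∫⁻ τ in Ioc (n : ℝ) ((n : ℝ) + 1), F τ :=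
        mul_le_mul_right (lintegral_iUnion_le _ _) _
    _ ≤ ENNReal.ofReal ν * ⨆ N : ℕ, ∫⁻ τ in Ioo (0 : ℝ) ((N : ℝ) + 1), F τ :=
        mul_le_mul_right hsum_le _
    _ = ⨆ N : ℕ, ENNReal.ofReal ν * ∫⁻ τ in Ioo (0 : ℝ) ((N : ℝ) + 1), F τ := ENNReal.mul_iSup _ _
    _ ≤ ENNReal.ofReal (VectorCalculus.kineticEnergy (u 0)) := iSup_le hslab

/-! ### 3. The defect at a good time -/


/-- **The defect estimate at a good time**, in `L²` form: for a `C¹` slice `v` bounded with bounded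
gradient, `v ∈ L²`, and `∫ |∇v|²_F ≤ δ` (Frobenius norm), `‖v - e^{σΔ}v‖_{L²} ≤ √(3σδ)` (Ledoux's
heat-flow defect `‖F - e^{tΔ}F‖₂² ≤ d t ‖DF‖₂²`, tree `integral_norm_sq_sub_heatExtension_le`, with
`‖Dv‖_{op} ≤ ‖Dv‖_F`). [cite: Ledoux2003, §1] -/
theorem eLpNorm_sub_heatExtension_le_of_dissipation
    {v : EuclideanSpace ℝ (Fin 3) → EuclideanSpace ℝ (Fin 3)} (hv : ContDiff ℝ 1 v) {C₀ C₁ : ℝ}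
    (h0 : ∀ z, ‖v z‖ ≤ C₀) (h1 : ∀ z, ‖fderiv ℝ v z‖ ≤ C₁) (hv2 : MemLp v 2 volume)
    {δ : ℝ} (hδ : 0 ≤ δ) (hD : ∫⁻ x, ENNReal.ofReal (frobeniusNormSq (fderiv ℝ v x)) ≤ ENNReal.ofReal δ)
    {σ : ℝ} (hσ : 0 < σ) :
    eLpNorm (v - heatExtension v σ) 2 volume ≤ ENNReal.ofReal (Real.sqrt (3 * σ * δ)) := by
  have h12 : (1 : ℝ≥0∞) ≤ 2 := by norm_num
  -- integrability of the Frobenius and operator norms of the gradient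
  have hDc : Continuous (fderiv ℝ v) := hv.continuous_fderiv one_ne_zero
  have hfc : Continuous fun x => frobeniusNormSq (fderiv ℝ v x) := by
    unfold frobeniusNormSq
    fun_prop
  have hfnn : ∀ x, 0 ≤ frobeniusNormSq (fderiv ℝ v x) := fun x => frobeniusNormSq_nonneg _
  have hDlt : ∫⁻ x, ENNReal.ofReal (frobeniusNormSq (fderiv ℝ v x)) < ⊤ :=
    hD.trans_lt ENNReal.ofReal_lt_top
  have hfint : Integrable (fun x => frobeniusNormSq (fderiv ℝ v x)) := by
    refine ⟨hfc.aestronglyMeasurable, ?_⟩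
    rw [hasFiniteIntegral_iff_ofReal (Eventually.of_forall hfnn)]
    exact hDlt
  have hopint : Integrable (fun x => ‖fderiv ℝ v x‖ ^ 2) := by
    refine hfint.mono (hDc.norm.pow 2).aestronglyMeasurable (Eventually.of_forall fun x => ?_)
    rw [Real.norm_of_nonneg (sq_nonneg _), Real.norm_of_nonneg (hfnn x)]
    exact norm_sq_le_frobeniusNormSq _
  have hv2int : Integrable (fun x => ‖v x‖ ^ 2) := hv2.integrable_norm_pow two_ne_zero
  -- Ledoux's defect bound, then comparison with the Frobenius dissipation
  have hdef := UnboundedOperators.integral_norm_sq_sub_heatExtension_le hσ hv h0 h1 hv2int hopint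
  rw [finrank_euclideanSpace_fin] at hdef
  have hfrob : ∫ x, ‖fderiv ℝ v x‖ ^ 2 ≤ δ := by
    calc ∫ x, ‖fderiv ℝ v x‖ ^ 2 ≤ ∫ x, frobeniusNormSq (fderiv ℝ v x) :=
          integral_mono hopint hfint fun x => norm_sq_le_frobeniusNormSq _
      _ = (∫⁻ x, ENNReal.ofReal (frobeniusNormSq (fderiv ℝ v x))).toReal :=
          integral_eq_lintegral_of_nonneg_ae (Eventually.of_forall hfnn) hfc.aestronglyMeasurable
      _ ≤ δ := by
          have := ENNReal.toReal_mono ENNReal.ofReal_ne_top hD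
          rwa [ENNReal.toReal_ofReal hδ] at this
  have hsq : ∫ x, ‖v x - heatExtension v σ x‖ ^ 2 ≤ 3 * σ * δ := by
    calc ∫ x, ‖v x - heatExtension v σ x‖ ^ 2 ≤ ((3 : ℕ) : ℝ) * σ * ∫ x, ‖fderiv ℝ v x‖ ^ 2 := hdef
      _ ≤ 3 * σ * δ := by
          push_cast
          exact mul_le_mul_of_nonneg_left hfrob (by positivity)
  -- convert to `eLpNorm`
  have hmem : MemLp (v - heatExtension v σ) 2 volume :=
    hv2.sub (UnboundedOperators.memLp_heatExtension_holds hv2 h12 hσ)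
  have heq : ∫ x, ‖(v - heatExtension v σ) x‖ ^ 2 = (eLpNorm (v - heatExtension v σ) 2 volume).toReal ^ 2 :=
    UnboundedOperators.integral_norm_sq_eq_toReal_eLpNorm_sq hmem
  have hle : (eLpNorm (v - heatExtension v σ) 2 volume).toReal ≤ Real.sqrt (3 * σ * δ) := by
    refine Real.le_sqrt_of_sq_le ?_
    rw [← heq]
    simpa only [Pi.sub_apply] using hsq
  rw [← ENNReal.ofReal_toReal hmem.eLpNorm_ne_top]
  exact ENNReal.ofReal_le_ofReal hle

end EnergyDecay

end Literature.Analysis.FluidPDE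

end
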